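import Summits.QuantumFields.YangMills.Theses.TypicalExteriorCeilings
import Summits.QuantumFields.YangMills.Theorems.OnsetCalibrationOnsetVanishes

/-!
# Route `TypicalExteriorCeilings` — `Assembly` (stmt-QuantumFields-25895) BY NAME

Seat `ym-line-sfw-p1` g12 (2026-08-28).  Pure bookkeeping so that the ledger shows the route = its cruxes and supports: the assembly item
`AnnealedBoundaryLaw → FloorsCond → HolderTransfer → FactorialCalibration → HypercubicOSDataFromInfiniteVolume` is modus ponens over the two
supports plus the landed `OnsetCalibration.onsetVanishes_proof` (exactly the planner's one-liner in the route file).  Rung R2a-IV is a RECORD-label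
rung; no crux, no ceiling and no summit is proved here; the Yang–Mills mass gap is NOT proved.  No definitions, no `sorry`.
-/

namespace Summit.QuantumFields.YangMills.Theorems

/-- ★ `TypicalExteriorCeilings.Assembly` (stmt-QuantumFields-25895): `hC (hH hK) hF onsetVanishes_proof`. [cite: OsterwalderSchrader1975, §2] -/
theorem typicalExteriorCeilings_assembly_proof : Summit.QuantumFields.YangMills.Theses.TypicalExteriorCeilings.Assembly :=
  fun hK hF hH hC => hC (hH hK) hF OnsetCalibration.onsetVanishes_proof

end Summit.QuantumFields.YangMills.Theorems
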